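import Mathlib
import Summits.ValiantsHypothesis.ValiantsHypothesis.Theses.ValuativeGCT
import Summits.ValiantsHypothesis.ValiantsHypothesis.Theorems.ValuativeGCTValuativeFlipInnerMonotone
import Summits.ValiantsHypothesis.ValiantsHypothesis.Theorems.ValuativeGCTValuativeFlipTailSuffices

/-!
# `ValuativeGCT.ValuativeFlip` (stmt-ValiantsHypothesis-12624): sparse inner sizes suffice —
# size-transfer axis, part IV (transfer between inner sizes across window columns)

Wall-breaker k12/16 (axis "representation-stability transfer between sizes"), seat 4, 2026-08-16.
Parts I–III of the axis (`…InnerMonotone`, `…InnerMonotoneEdges`, `…DiagonalInheritance`, and k16's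
`…TailSuffices`) settled which window POSITIONS carry the crux: the flip body is upward closed in the
inner size `n` at fixed matrix size `m` (`flipBody_mono_inner`), so only the steep edge matters, only
super-polynomially padded positions matter (`valuativeFlip_iff_polyPadded`), and `TailFlip ⇔ ValuativeFlip`.
This file adds the transfer ACROSS window columns that the universal quantifier over the window exponent
`c` makes free: the window relation `n ≤ m ≤ 2^((log₂ n + c)^c)` is transitive up to an explicit change of
exponent (`sis_window_trans`; monotonicity in the exponent is `qpBound_mono`: `n ≤ W_{c₀}(s) ⇒ W_c(n) ≤ W_{c₀c+c+c₀+1}(s)`), hence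

* `forall_window_of_onSet` — for ANY predicate `P n m` upward closed in `n ≤ m`, the windowed statement
  `∀ c, ∃ n₀, ∀ n ≥ n₀, ∀ m ∈ [n, W_c(n)], P n m` follows from its restriction to inner sizes `n` in any set
  `S ⊆ ℕ` that is WINDOW-SYNDETIC (every large `n` lies in `[s, W_{c₀}(s)]` for some `s ∈ S`, one fixed `c₀`);
* `valuativeFlip_iff_onSet` — so `ValuativeFlip` is EQUIVALENT to its restriction to the inner sizes of any
  window-syndetic set; `valuativeFlip_iff_onSet_of_sqGaps` — in particular of any set meeting every interval
  `[√n, n]` eventually (`c₀ = 2`), e.g. `{2^(2^k)}`;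
* `valuativeFlip_iff_modEq` — e.g. the inner sizes of one residue class `n ≡ a (mod q)` suffice (odd `n`,
  multiples of `4`, …);
* `valuativeFlip_of_tailFlipOn`, `valuativeFlip_of_tailFlip_modEq` — the same sparsification for the tail
  child (`TailFlip` over a window-syndetic set of inner sizes already gives the whole crux).
The sibling file `…ValuativeFlipPowTwoInnerSizes` gives the sharpest normal form on this axis (inner sizes
powers of two, padding at least polynomial, SAME window exponent: `log₂ 2^k = k`).

Use: a per-side engine for `per_n` may assume any convenient arithmetic form of the inner size (`n` a power
of two, `4 ∣ n`, …) at no cost.  It does NOT thin out the matrix sizes `m` (no monotone transfer of the flip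
body between levels exists, k12 gens 0–2 / k16) nor touch the residual crux (`TailFlip ≡ ValuativeFlip`).
Pure logic over part I and window arithmetic. [this crux; elementary]
-/

set_option linter.dupNamespace false

namespace Summit.ValiantsHypothesis.ValiantsHypothesis.Theorems.ValuativeFlip

open scoped BigOperators Matrix
open MvPolynomial
open Literature.NumberTheory.DiophantineGeometry
open Literature.Computability.AlgebraicComplexity
open Summit.ValiantsHypothesis.ValiantsHypothesis.Theses.ValuativeGCT
open Summit.ValiantsHypothesis.Theorems.DetqpThesis.Negative (qpBound_mono)

noncomputable section

/-! ## Window arithmetic -/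

/-- A window bound on `n` bounds `log₂ n`: `n ≤ W_{c₀}(s) ⇒ log₂ n ≤ (log₂ s + c₀)^(c₀)`. [folklore] -/
theorem sis_log_le_of_le_window {n s c₀ : ℕ} (h : n ≤ 2 ^ ((Nat.log 2 s + c₀) ^ c₀)) :
    Nat.log 2 n ≤ (Nat.log 2 s + c₀) ^ c₀ :=
  calc Nat.log 2 n ≤ Nat.log 2 (2 ^ ((Nat.log 2 s + c₀) ^ c₀)) := Nat.log_mono_right h
    _ = (Nat.log 2 s + c₀) ^ c₀ := Nat.log_pow (by norm_num) _

/-- **The window relation is transitive up to a change of exponent.**  If `n` lies in the window of `s`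
with exponent `c₀`, then the whole window of `n` with exponent `c` lies in the window of `s` with exponent
`c₀·c + c + c₀ + 1`: `n ≤ W_{c₀}(s) ⇒ W_c(n) ≤ W_{c₀c+c+c₀+1}(s)`.  (`log₂ n ≤ (L+c₀)^(c₀)` with
`L = log₂ s`, so `(log₂ n + c)^c ≤ ((L+c₀)^(c₀)·(1+c))^c = (L+c₀)^(c₀c)·(1+c)^c ≤ (L+c')^(c₀c+c)`.)
[folklore] -/
theorem sis_window_trans (c₀ c : ℕ) {n s : ℕ} (h : n ≤ 2 ^ ((Nat.log 2 s + c₀) ^ c₀)) :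
    2 ^ ((Nat.log 2 n + c) ^ c) ≤
      2 ^ ((Nat.log 2 s + (c₀ * c + c + c₀ + 1)) ^ (c₀ * c + c + c₀ + 1)) := by
  apply Nat.pow_le_pow_right (by norm_num)
  have hlog := sis_log_le_of_le_window h
  generalize hL : Nat.log 2 s = L at hlog ⊢
  generalize hP : c₀ * c = P
  have hA : 1 ≤ (L + c₀) ^ c₀ := by
    rcases Nat.eq_zero_or_pos c₀ with h0 | h0
    · subst h0
      simp
    · exact Nat.one_le_pow _ _ (by omega)
  have h1 : Nat.log 2 n + c ≤ (L + c₀) ^ c₀ * (1 + c) := by nlinarith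
  calc (Nat.log 2 n + c) ^ c ≤ ((L + c₀) ^ c₀ * (1 + c)) ^ c := Nat.pow_le_pow_left h1 c
    _ = (L + c₀) ^ (c₀ * c) * (1 + c) ^ c := by rw [mul_pow, ← pow_mul]
    _ ≤ (L + (P + c + c₀ + 1)) ^ (c₀ * c) * (L + (P + c + c₀ + 1)) ^ c :=
        Nat.mul_le_mul (Nat.pow_le_pow_left (by omega) _) (Nat.pow_le_pow_left (by omega) _)
    _ = (L + (P + c + c₀ + 1)) ^ (P + c) := by rw [← pow_add, hP]
    _ ≤ (L + (P + c + c₀ + 1)) ^ (P + c + c₀ + 1) := Nat.pow_le_pow_right (by omega) (by omega)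

/-- Square gaps fit in the window with exponent `2`: `n ≤ s² ⇒ n ≤ W₂(s) = 2^((log₂ s + 2)^2)`
(`s < 2^(log₂ s + 1)`, so `s² < 2^(2 log₂ s + 2) ≤ 2^((log₂ s + 2)^2)`). [folklore] -/
theorem sis_le_window_two_of_le_sq {n s : ℕ} (h : n ≤ s * s) :
    n ≤ 2 ^ ((Nat.log 2 s + 2) ^ 2) := by
  have h1 : s < 2 ^ (Nat.log 2 s + 1) := Nat.lt_pow_succ_log_self (by norm_num) s
  have h2 : s * s ≤ 2 ^ (Nat.log 2 s + 1) * 2 ^ (Nat.log 2 s + 1) := Nat.mul_le_mul h1.le h1.le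
  refine h.trans (h2.trans ?_)
  rw [← pow_add]
  exact Nat.pow_le_pow_right (by norm_num) (by nlinarith)

/-- `n < 2s` with `2 ≤ s` gives `n ≤ s²`. [folklore] -/
theorem sis_le_sq_of_lt_two_mul {n s : ℕ} (hs : 2 ≤ s) (h : n < 2 * s) : n ≤ s * s := by
  nlinarith

/-! ## The abstract transfer across window columns -/

/-- **Window-syndetic sets of inner sizes suffice (abstract form).**  Let `P n m` be upward closed in
the inner size (`P n m → P n' m` for `n ≤ n' ≤ m`).  Suppose `S ⊆ ℕ` is window-syndetic with exponent
`c₀`: every `n ≥ n₁` satisfies `s ≤ n ≤ W_{c₀}(s)` for some `s ∈ S`.  If the windowed statement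
`∀ c, ∃ n₀, ∀ n ≥ n₀, n ∈ S → ∀ m, n ≤ m ≤ W_c(n) → P n m` holds ON `S`, then it holds for all inner
sizes: given `c`, use the hypothesis with exponent `c' = c₀c + c + c₀ + 1`; a position `(n, m)` is reached
from `(s, m)`, which lies in the `c'`-window of `s` by `sis_window_trans`, and `s` is large because
`n ≤ W_{c₀}(s)`. [this file; elementary] -/
theorem forall_window_of_onSet {P : ℕ → ℕ → Prop}
    (hmono : ∀ n n' m, n ≤ n' → n' ≤ m → P n m → P n' m)
    {S : Set ℕ} {c₀ n₁ : ℕ}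
    (hS : ∀ n ≥ n₁, ∃ s ∈ S, s ≤ n ∧ n ≤ 2 ^ ((Nat.log 2 s + c₀) ^ c₀))
    (h : ∀ c : ℕ, ∃ n₀ : ℕ, ∀ n ≥ n₀, n ∈ S → ∀ m, n ≤ m → m ≤ 2 ^ ((Nat.log 2 n + c) ^ c) → P n m) :
    ∀ c : ℕ, ∃ n₀ : ℕ, ∀ n ≥ n₀, ∀ m, n ≤ m → m ≤ 2 ^ ((Nat.log 2 n + c) ^ c) → P n m := by
  intro c
  obtain ⟨n₀, hn₀⟩ := h (c₀ * c + c + c₀ + 1)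
  refine ⟨max n₁ (2 ^ ((Nat.log 2 n₀ + c₀) ^ c₀) + 1), fun n hn m hnm hm => ?_⟩
  obtain ⟨s, hsS, hsn, hns⟩ := hS n (le_of_max_le_left hn)
  have hs₀ : n₀ ≤ s := by
    by_contra hlt
    rw [not_le] at hlt
    have h1 : n ≤ 2 ^ ((Nat.log 2 n₀ + c₀) ^ c₀) := hns.trans (window_mono c₀ hlt.le)
    have h2 : 2 ^ ((Nat.log 2 n₀ + c₀) ^ c₀) + 1 ≤ n := le_of_max_le_right hn
    exact absurd (lt_of_lt_of_le (Nat.lt_succ_iff.mpr h1) h2) (lt_irrefl n)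
  exact hmono s n m hsn hnm (hn₀ s hs₀ hsS m (hsn.trans hnm) (hm.trans (sis_window_trans c₀ c hns)))

/-- Square-gap sets are window-syndetic with exponent `2`: if every `n ≥ n₁` has some `s ∈ S` with
`s ≤ n ≤ s²`, then `s ≤ n ≤ W₂(s)`. [this file; elementary] -/
theorem windowSyndetic_of_sqGaps {S : Set ℕ} {n₁ : ℕ}
    (hS : ∀ n ≥ n₁, ∃ s ∈ S, s ≤ n ∧ n ≤ s * s) :
    ∀ n ≥ n₁, ∃ s ∈ S, s ≤ n ∧ n ≤ 2 ^ ((Nat.log 2 s + 2) ^ 2) := by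
  intro n hn
  obtain ⟨s, hsS, hsn, hns⟩ := hS n hn
  exact ⟨s, hsS, hsn, sis_le_window_two_of_le_sq hns⟩

/-- Residue classes have square gaps: for `a < q` and `n ≥ 2q` there is `s ≡ a (mod q)` with
`s ≤ n ≤ s²` (take `s = a + q·⌊(n-a)/q⌋`, so `n - q < s ≤ n` and `2 ≤ q + 1 ≤ s`). [folklore] -/
theorem sqGaps_modEq {q a : ℕ} (ha : a < q) :
    ∀ n ≥ 2 * q, ∃ s ∈ {t : ℕ | t % q = a}, s ≤ n ∧ n ≤ s * s := by
  intro n hn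
  have hq : 0 < q := by omega
  have hdm : q * ((n - a) / q) + (n - a) % q = n - a := Nat.div_add_mod (n - a) q
  have hr : (n - a) % q < q := Nat.mod_lt _ hq
  refine ⟨a + q * ((n - a) / q), ?_, ?_, ?_⟩
  · show (a + q * ((n - a) / q)) % q = a
    rw [Nat.add_mul_mod_self_left, Nat.mod_eq_of_lt ha]
  · obtain ⟨Q, hQ⟩ : ∃ Q, q * ((n - a) / q) = Q := ⟨_, rfl⟩
    rw [hQ] at hdm ⊢
    omega
  · obtain ⟨Q, hQ⟩ : ∃ Q, q * ((n - a) / q) = Q := ⟨_, rfl⟩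
    rw [hQ] at hdm ⊢
    exact sis_le_sq_of_lt_two_mul (by omega) (by omega)

/-- Powers of two have square gaps: for `n ≥ 2`, `s = 2^(log₂ n)` has `s ≤ n ≤ s²`. [folklore] -/
theorem sqGaps_powTwo :
    ∀ n ≥ 2, ∃ s ∈ Set.range (fun k : ℕ => 2 ^ k), s ≤ n ∧ n ≤ s * s := by
  intro n hn
  refine ⟨2 ^ Nat.log 2 n, ⟨Nat.log 2 n, rfl⟩, Nat.pow_log_le_self 2 (by omega), ?_⟩
  have h1 : n < 2 ^ (Nat.log 2 n + 1) := Nat.lt_pow_succ_log_self (by norm_num) n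
  have h2 : 2 ≤ 2 ^ Nat.log 2 n := by
    have : 1 ≤ Nat.log 2 n := Nat.le_log_of_pow_le (by norm_num) (by simpa using hn)
    calc (2 : ℕ) = 2 ^ 1 := (pow_one 2).symm
      _ ≤ 2 ^ Nat.log 2 n := Nat.pow_le_pow_right (by norm_num) this
  apply sis_le_sq_of_lt_two_mul h2
  calc n < 2 ^ (Nat.log 2 n + 1) := h1
    _ = 2 * 2 ^ Nat.log 2 n := by rw [pow_succ, mul_comm]

/-! ## The crux over sparse sets of inner sizes -/

/-- **`ValuativeFlip` is equivalent to its restriction to the inner sizes of any window-syndetic set `S`.**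
`→` is the restriction; `←` is `forall_window_of_onSet` with `P n m :=` the flip body at `(n, m)` (verbatim
the route decl's), which is upward closed in `n` by inner monotonicity (`flipBody_mono_inner`: the
valuative truncation does not depend on `n`, and `mult ℂ[Δ_m(X₀₀^{m-s} per_s)] ≤ mult ℂ[Δ_m(X₀₀^{m-n} per_n)]`
for `s ≤ n ≤ m`). [this file] -/
theorem valuativeFlip_iff_onSet (S : Set ℕ) (c₀ n₁ : ℕ)
    (hS : ∀ n ≥ n₁, ∃ s ∈ S, s ≤ n ∧ n ≤ 2 ^ ((Nat.log 2 s + c₀) ^ c₀)) :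
    ValuativeFlip ↔ ∀ c : ℕ, ∃ n₀ : ℕ, ∀ n ≥ n₀, n ∈ S → ∀ (m : ℕ) [NeZero m], n ≤ m → m ≤ 2 ^ ((Nat.log 2 n + c) ^ c) →
    ∃ (U : Submodule ℂ (MatIdx m → ℂ)) (r δ : ℕ) (lam : Nat.Partition (m * δ)),
          (∀ u ∈ U, (Matrix.of fun a b : Fin m => u (toLex (a, b))).rank ≤ r) ∧ lam.parts.card ≤ m * m ∧
            Module.finrank ℂ ↥(MvPolynomial.homogeneousSubmodule (MatIdx m × MatIdx m) ℂ (m * δ) ⊓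
                ((MvPolynomial.vanishingIdeal ℂ
                    {p : MatIdx m × MatIdx m → ℂ | ∀ j : MatIdx m, (fun i => p (j, i)) ∈ U}) ^ (δ * (m - r))).restrictScalars ℂ ⊓
                (⨅ (M : Matrix (MatIdx m) (MatIdx m) ℂ)
                  (_ : linSubst (MatIdx m) ℂ M (detFormLex ℂ m) = detFormLex ℂ m),
                  LinearMap.ker ((MvPolynomial.aeval fun p : MatIdx m × MatIdx m =>
                      ∑ l : MatIdx m, M l p.2 •
                        (MvPolynomial.X (p.1, l) : MvPolynomial (MatIdx m × MatIdx m) ℂ)).toLinearMap -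
                    (LinearMap.id : MvPolynomial (MatIdx m × MatIdx m) ℂ →ₗ[ℂ] MvPolynomial (MatIdx m × MatIdx m) ℂ))) ⊓
                (⨅ (g : Matrix.GeneralLinearGroup (MatIdx m) ℂ) (_ : IsUpperTriangular g),
                  LinearMap.ker ((MvPolynomial.aeval fun p : MatIdx m × MatIdx m =>
                      ∑ l : MatIdx m, ((g⁻¹ : Matrix.GeneralLinearGroup (MatIdx m) ℂ) :
                        Matrix (MatIdx m) (MatIdx m) ℂ) p.1 l •
                          (MvPolynomial.X (l, p.2) : MvPolynomial (MatIdx m × MatIdx m) ℂ)).toLinearMap -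
                    weightChar ((Weight.dualOfPartition (m * m) lam).toMatIdx : Weight (MatIdx m)) g •
                      (LinearMap.id : MvPolynomial (MatIdx m × MatIdx m) ℂ →ₗ[ℂ] MvPolynomial (MatIdx m × MatIdx m) ℂ)))) <
              orbitMultiplicity ℂ (paddedPerFormLex ℂ n m) m
                ((Weight.dualOfPartition (m * m) lam).toMatIdx : Weight (MatIdx m)) := by
  constructor
  · intro hV c
    obtain ⟨n₀, hn₀⟩ := hV c
    exact ⟨n₀, fun n hn _ m _ hnm hm => hn₀ n hn m hnm hm⟩
  · intro H c
    obtain ⟨n₀, hn₀⟩ := forall_window_of_onSet (S := S) (c₀ := c₀) (n₁ := n₁)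
      (P := fun n m => ∀ _ : NeZero m,
        ∃ (U : Submodule ℂ (MatIdx m → ℂ)) (r δ : ℕ) (lam : Nat.Partition (m * δ)),
              (∀ u ∈ U, (Matrix.of fun a b : Fin m => u (toLex (a, b))).rank ≤ r) ∧ lam.parts.card ≤ m * m ∧
                Module.finrank ℂ ↥(MvPolynomial.homogeneousSubmodule (MatIdx m × MatIdx m) ℂ (m * δ) ⊓
                    ((MvPolynomial.vanishingIdeal ℂ
                        {p : MatIdx m × MatIdx m → ℂ | ∀ j : MatIdx m, (fun i => p (j, i)) ∈ U}) ^ (δ * (m - r))).restrictScalars ℂ ⊓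
                    (⨅ (M : Matrix (MatIdx m) (MatIdx m) ℂ)
                      (_ : linSubst (MatIdx m) ℂ M (detFormLex ℂ m) = detFormLex ℂ m),
                      LinearMap.ker ((MvPolynomial.aeval fun p : MatIdx m × MatIdx m =>
                          ∑ l : MatIdx m, M l p.2 •
                            (MvPolynomial.X (p.1, l) : MvPolynomial (MatIdx m × MatIdx m) ℂ)).toLinearMap -
                        (LinearMap.id : MvPolynomial (MatIdx m × MatIdx m) ℂ →ₗ[ℂ] MvPolynomial (MatIdx m × MatIdx m) ℂ))) ⊓
                    (⨅ (g : Matrix.GeneralLinearGroup (MatIdx m) ℂ) (_ : IsUpperTriangular g),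
                      LinearMap.ker ((MvPolynomial.aeval fun p : MatIdx m × MatIdx m =>
                          ∑ l : MatIdx m, ((g⁻¹ : Matrix.GeneralLinearGroup (MatIdx m) ℂ) :
                            Matrix (MatIdx m) (MatIdx m) ℂ) p.1 l •
                              (MvPolynomial.X (l, p.2) : MvPolynomial (MatIdx m × MatIdx m) ℂ)).toLinearMap -
                        weightChar ((Weight.dualOfPartition (m * m) lam).toMatIdx : Weight (MatIdx m)) g •
                          (LinearMap.id : MvPolynomial (MatIdx m × MatIdx m) ℂ →ₗ[ℂ] MvPolynomial (MatIdx m × MatIdx m) ℂ)))) <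
                  orbitMultiplicity ℂ (paddedPerFormLex ℂ n m) m
                    ((Weight.dualOfPartition (m * m) lam).toMatIdx : Weight (MatIdx m)))
      (fun n n' m hnn' hn'm hP inst => flipBody_mono_inner hnn' hn'm (hP inst)) hS
      (fun c' => by
        obtain ⟨n₀, hn₀⟩ := H c'
        exact ⟨n₀, fun n hn hnS m hnm hm inst => hn₀ n hn hnS m hnm hm⟩) c
    exact ⟨n₀, fun n hn m inst hnm hm => hn₀ n hn m hnm hm inst⟩

/-- **Square-gap sets suffice.**  If `S` meets `[√n, n]` for every large `n` (some `s ∈ S` with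
`s ≤ n ≤ s²`), then `ValuativeFlip` is equivalent to its restriction to inner sizes in `S` (window
exponent `c₀ = 2`, `windowSyndetic_of_sqGaps`).  Examples: powers of two, `{2^(2^k)}`, residue classes,
perfect squares, factorials. [this file] -/
theorem valuativeFlip_iff_onSet_of_sqGaps (S : Set ℕ) (n₁ : ℕ)
    (hS : ∀ n ≥ n₁, ∃ s ∈ S, s ≤ n ∧ n ≤ s * s) :
    ValuativeFlip ↔ ∀ c : ℕ, ∃ n₀ : ℕ, ∀ n ≥ n₀, n ∈ S → ∀ (m : ℕ) [NeZero m], n ≤ m → m ≤ 2 ^ ((Nat.log 2 n + c) ^ c) →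
    ∃ (U : Submodule ℂ (MatIdx m → ℂ)) (r δ : ℕ) (lam : Nat.Partition (m * δ)),
          (∀ u ∈ U, (Matrix.of fun a b : Fin m => u (toLex (a, b))).rank ≤ r) ∧ lam.parts.card ≤ m * m ∧
            Module.finrank ℂ ↥(MvPolynomial.homogeneousSubmodule (MatIdx m × MatIdx m) ℂ (m * δ) ⊓
                ((MvPolynomial.vanishingIdeal ℂ
                    {p : MatIdx m × MatIdx m → ℂ | ∀ j : MatIdx m, (fun i => p (j, i)) ∈ U}) ^ (δ * (m - r))).restrictScalars ℂ ⊓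
                (⨅ (M : Matrix (MatIdx m) (MatIdx m) ℂ)
                  (_ : linSubst (MatIdx m) ℂ M (detFormLex ℂ m) = detFormLex ℂ m),
                  LinearMap.ker ((MvPolynomial.aeval fun p : MatIdx m × MatIdx m =>
                      ∑ l : MatIdx m, M l p.2 •
                        (MvPolynomial.X (p.1, l) : MvPolynomial (MatIdx m × MatIdx m) ℂ)).toLinearMap -
                    (LinearMap.id : MvPolynomial (MatIdx m × MatIdx m) ℂ →ₗ[ℂ] MvPolynomial (MatIdx m × MatIdx m) ℂ))) ⊓
                (⨅ (g : Matrix.GeneralLinearGroup (MatIdx m) ℂ) (_ : IsUpperTriangular g),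
                  LinearMap.ker ((MvPolynomial.aeval fun p : MatIdx m × MatIdx m =>
                      ∑ l : MatIdx m, ((g⁻¹ : Matrix.GeneralLinearGroup (MatIdx m) ℂ) :
                        Matrix (MatIdx m) (MatIdx m) ℂ) p.1 l •
                          (MvPolynomial.X (l, p.2) : MvPolynomial (MatIdx m × MatIdx m) ℂ)).toLinearMap -
                    weightChar ((Weight.dualOfPartition (m * m) lam).toMatIdx : Weight (MatIdx m)) g •
                      (LinearMap.id : MvPolynomial (MatIdx m × MatIdx m) ℂ →ₗ[ℂ] MvPolynomial (MatIdx m × MatIdx m) ℂ)))) <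
              orbitMultiplicity ℂ (paddedPerFormLex ℂ n m) m
                ((Weight.dualOfPartition (m * m) lam).toMatIdx : Weight (MatIdx m)) :=
  valuativeFlip_iff_onSet S 2 n₁ (windowSyndetic_of_sqGaps hS)

/-- **One residue class of inner sizes suffices.**  For `a < q`, `ValuativeFlip` is equivalent to the same
statement with the inner size restricted to `n ≡ a (mod q)` (e.g. odd `n`, or `4 ∣ n`).  [this file] -/
theorem valuativeFlip_iff_modEq (q a : ℕ) (ha : a < q) :
    ValuativeFlip ↔ ∀ c : ℕ, ∃ n₀ : ℕ, ∀ n ≥ n₀, n % q = a → ∀ (m : ℕ) [NeZero m], n ≤ m → m ≤ 2 ^ ((Nat.log 2 n + c) ^ c) →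
    ∃ (U : Submodule ℂ (MatIdx m → ℂ)) (r δ : ℕ) (lam : Nat.Partition (m * δ)),
          (∀ u ∈ U, (Matrix.of fun a b : Fin m => u (toLex (a, b))).rank ≤ r) ∧ lam.parts.card ≤ m * m ∧
            Module.finrank ℂ ↥(MvPolynomial.homogeneousSubmodule (MatIdx m × MatIdx m) ℂ (m * δ) ⊓
                ((MvPolynomial.vanishingIdeal ℂ
                    {p : MatIdx m × MatIdx m → ℂ | ∀ j : MatIdx m, (fun i => p (j, i)) ∈ U}) ^ (δ * (m - r))).restrictScalars ℂ ⊓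
                (⨅ (M : Matrix (MatIdx m) (MatIdx m) ℂ)
                  (_ : linSubst (MatIdx m) ℂ M (detFormLex ℂ m) = detFormLex ℂ m),
                  LinearMap.ker ((MvPolynomial.aeval fun p : MatIdx m × MatIdx m =>
                      ∑ l : MatIdx m, M l p.2 •
                        (MvPolynomial.X (p.1, l) : MvPolynomial (MatIdx m × MatIdx m) ℂ)).toLinearMap -
                    (LinearMap.id : MvPolynomial (MatIdx m × MatIdx m) ℂ →ₗ[ℂ] MvPolynomial (MatIdx m × MatIdx m) ℂ))) ⊓
                (⨅ (g : Matrix.GeneralLinearGroup (MatIdx m) ℂ) (_ : IsUpperTriangular g),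
                  LinearMap.ker ((MvPolynomial.aeval fun p : MatIdx m × MatIdx m =>
                      ∑ l : MatIdx m, ((g⁻¹ : Matrix.GeneralLinearGroup (MatIdx m) ℂ) :
                        Matrix (MatIdx m) (MatIdx m) ℂ) p.1 l •
                          (MvPolynomial.X (l, p.2) : MvPolynomial (MatIdx m × MatIdx m) ℂ)).toLinearMap -
                    weightChar ((Weight.dualOfPartition (m * m) lam).toMatIdx : Weight (MatIdx m)) g •
                      (LinearMap.id : MvPolynomial (MatIdx m × MatIdx m) ℂ →ₗ[ℂ] MvPolynomial (MatIdx m × MatIdx m) ℂ)))) <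
              orbitMultiplicity ℂ (paddedPerFormLex ℂ n m) m
                ((Weight.dualOfPartition (m * m) lam).toMatIdx : Weight (MatIdx m)) :=
  valuativeFlip_iff_onSet_of_sqGaps {t : ℕ | t % q = a} (2 * q) (sqGaps_modEq ha)

/-! ## The tail child over sparse inner sizes -/

/-- Largeness transfer along a window: if `t ≤ W_{c₀}(s)` and `t > W_{c₀}(n₀)`, then `n₀ ≤ s`
(the window bound is monotone in the inner size, `window_mono`). [this file; elementary] -/
theorem sis_le_of_window {c₀ n₀ s t : ℕ} (hts : t ≤ 2 ^ ((Nat.log 2 s + c₀) ^ c₀))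
    (ht : 2 ^ ((Nat.log 2 n₀ + c₀) ^ c₀) + 1 ≤ t) : n₀ ≤ s := by
  by_contra hlt
  rw [not_le] at hlt
  have h1 : t ≤ 2 ^ ((Nat.log 2 n₀ + c₀) ^ c₀) := hts.trans (window_mono c₀ hlt.le)
  exact absurd (lt_of_lt_of_le (Nat.lt_succ_iff.mpr h1) ht) (lt_irrefl t)

/-- **`TailFlip` over a window-syndetic set of inner sizes already gives the whole crux.**  If the tail
statement (slope `a/b`, exponent `c`, body verbatim) holds with the inner size restricted to a
window-syndetic set `S` (exponent `c₀`), then `ValuativeFlip` holds.  Given `c`, use slope `2` and exponent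
`c' = c₀(c+2) + (c+2) + c₀ + 1` on `S`; a position `(n, m)` with `2n < m` is reached from `(s, m)` with
`s ∈ S`, `s ≤ n ≤ W_{c₀}(s)`; a position with `m ≤ 2n` from `(s, m)` with `s ≤ ⌊(m-1)/2⌋ ≤ W_{c₀}(s)`
(`m ≤ 2⌊(m-1)/2⌋ + 2 ≤ W_{c+2}(⌊(m-1)/2⌋)`, `two_mul_add_two_le_window`); in both cases `2s < m`,
`m ≤ W_{c'}(s)` by `sis_window_trans`, and the flip moves up from `s` to `n` by `flipBody_mono_inner`.
(With `S = ℕ` this is k16's `valuativeFlip_of_tailFlip`.) [this file] -/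
theorem valuativeFlip_of_tailFlipOn (S : Set ℕ) (c₀ n₁ : ℕ)
    (hS : ∀ n ≥ n₁, ∃ s ∈ S, s ≤ n ∧ n ≤ 2 ^ ((Nat.log 2 s + c₀) ^ c₀))
    (hT : ∀ a b : ℕ, b < a → ∀ c : ℕ, ∃ n₀ : ℕ, ∀ n ≥ n₀, n ∈ S → ∀ (m : ℕ) [NeZero m],
      a * n < b * m → m ≤ 2 ^ ((Nat.log 2 n + c) ^ c) →
      ∃ (U : Submodule ℂ (MatIdx m → ℂ)) (r δ : ℕ) (lam : Nat.Partition (m * δ)),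
            (∀ u ∈ U, (Matrix.of fun a b : Fin m => u (toLex (a, b))).rank ≤ r) ∧ lam.parts.card ≤ m * m ∧
              Module.finrank ℂ ↥(MvPolynomial.homogeneousSubmodule (MatIdx m × MatIdx m) ℂ (m * δ) ⊓
                  ((MvPolynomial.vanishingIdeal ℂ
                      {p : MatIdx m × MatIdx m → ℂ | ∀ j : MatIdx m, (fun i => p (j, i)) ∈ U}) ^ (δ * (m - r))).restrictScalars ℂ ⊓
                  (⨅ (M : Matrix (MatIdx m) (MatIdx m) ℂ)
                    (_ : linSubst (MatIdx m) ℂ M (detFormLex ℂ m) = detFormLex ℂ m),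
                    LinearMap.ker ((MvPolynomial.aeval fun p : MatIdx m × MatIdx m =>
                        ∑ l : MatIdx m, M l p.2 •
                          (MvPolynomial.X (p.1, l) : MvPolynomial (MatIdx m × MatIdx m) ℂ)).toLinearMap -
                      (LinearMap.id : MvPolynomial (MatIdx m × MatIdx m) ℂ →ₗ[ℂ] MvPolynomial (MatIdx m × MatIdx m) ℂ))) ⊓
                  (⨅ (g : Matrix.GeneralLinearGroup (MatIdx m) ℂ) (_ : IsUpperTriangular g),
                    LinearMap.ker ((MvPolynomial.aeval fun p : MatIdx m × MatIdx m =>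
                        ∑ l : MatIdx m, ((g⁻¹ : Matrix.GeneralLinearGroup (MatIdx m) ℂ) :
                          Matrix (MatIdx m) (MatIdx m) ℂ) p.1 l •
                            (MvPolynomial.X (l, p.2) : MvPolynomial (MatIdx m × MatIdx m) ℂ)).toLinearMap -
                      weightChar ((Weight.dualOfPartition (m * m) lam).toMatIdx : Weight (MatIdx m)) g •
                        (LinearMap.id : MvPolynomial (MatIdx m × MatIdx m) ℂ →ₗ[ℂ] MvPolynomial (MatIdx m × MatIdx m) ℂ)))) <
                orbitMultiplicity ℂ (paddedPerFormLex ℂ n m) m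
                  ((Weight.dualOfPartition (m * m) lam).toMatIdx : Weight (MatIdx m))) :
    ValuativeFlip := by
  intro c
  obtain ⟨n₀, hn₀⟩ := hT 2 1 (by norm_num) (c₀ * (c + 2) + (c + 2) + c₀ + 1)
  refine ⟨max (2 * n₁ + 1) (2 * 2 ^ ((Nat.log 2 n₀ + c₀) ^ c₀) + 3), fun n hn m _ hnm hm => ?_⟩
  have hn₁ : 2 * n₁ + 1 ≤ n := le_of_max_le_left hn
  have hnW : 2 * 2 ^ ((Nat.log 2 n₀ + c₀) ^ c₀) + 3 ≤ n := le_of_max_le_right hn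
  by_cases hcase : 2 * n < m
  · -- steep enough: `(n, m)` is a tail position; move from `s ≤ n`, `s ∈ S`
    obtain ⟨s, hsS, hsn, hns⟩ := hS n (by omega)
    have hs₀ : n₀ ≤ s := sis_le_of_window hns (by omega)
    have h1 : 2 * s < 1 * m := by omega
    have h2 : m ≤ 2 ^ ((Nat.log 2 s + (c₀ * (c + 2) + (c + 2) + c₀ + 1)) ^ (c₀ * (c + 2) + (c + 2) + c₀ + 1)) :=
      (hm.trans (qpBound_mono (Nat.le_add_right c 2) n)).trans (sis_window_trans c₀ (c + 2) hns)
    obtain ⟨U, r, δ, lam, hU, hcard, hlt⟩ := hn₀ s hs₀ hsS m h1 h2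
    exact ⟨U, r, δ, lam, hU, hcard,
      lt_of_lt_of_le hlt (orbitMultiplicity_paddedPer_mono_inner hsn hnm _)⟩
  · -- shallow: move from `s ≤ ⌊(m-1)/2⌋`, `s ∈ S`, a tail position of the larger window
    obtain ⟨s, hsS, hst, hts⟩ := hS ((m - 1) / 2) (by omega)
    have hs₀ : n₀ ≤ s := sis_le_of_window hts (by omega)
    have h1 : 2 * s < 1 * m := by omega
    have h2 : m ≤ 2 ^ ((Nat.log 2 s + (c₀ * (c + 2) + (c + 2) + c₀ + 1)) ^ (c₀ * (c + 2) + (c + 2) + c₀ + 1)) :=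
      (le_trans (by omega) (two_mul_add_two_le_window c ((m - 1) / 2))).trans (sis_window_trans c₀ (c + 2) hts)
    have hsn : s ≤ n := by omega
    obtain ⟨U, r, δ, lam, hU, hcard, hlt⟩ := hn₀ s hs₀ hsS m h1 h2
    exact ⟨U, r, δ, lam, hU, hcard,
      lt_of_lt_of_le hlt (orbitMultiplicity_paddedPer_mono_inner hsn hnm _)⟩

/-- **`TailFlip` over one residue class of inner sizes gives the crux** (instance of
`valuativeFlip_of_tailFlipOn` with `S = {n ≡ a (mod q)}`, `a < q`). [this file] -/
theorem valuativeFlip_of_tailFlip_modEq (q a : ℕ) (ha : a < q)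
    (hT : ∀ a' b : ℕ, b < a' → ∀ c : ℕ, ∃ n₀ : ℕ, ∀ n ≥ n₀, n % q = a → ∀ (m : ℕ) [NeZero m],
      a' * n < b * m → m ≤ 2 ^ ((Nat.log 2 n + c) ^ c) →
      ∃ (U : Submodule ℂ (MatIdx m → ℂ)) (r δ : ℕ) (lam : Nat.Partition (m * δ)),
            (∀ u ∈ U, (Matrix.of fun a b : Fin m => u (toLex (a, b))).rank ≤ r) ∧ lam.parts.card ≤ m * m ∧
              Module.finrank ℂ ↥(MvPolynomial.homogeneousSubmodule (MatIdx m × MatIdx m) ℂ (m * δ) ⊓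
                  ((MvPolynomial.vanishingIdeal ℂ
                      {p : MatIdx m × MatIdx m → ℂ | ∀ j : MatIdx m, (fun i => p (j, i)) ∈ U}) ^ (δ * (m - r))).restrictScalars ℂ ⊓
                  (⨅ (M : Matrix (MatIdx m) (MatIdx m) ℂ)
                    (_ : linSubst (MatIdx m) ℂ M (detFormLex ℂ m) = detFormLex ℂ m),
                    LinearMap.ker ((MvPolynomial.aeval fun p : MatIdx m × MatIdx m =>
                        ∑ l : MatIdx m, M l p.2 •
                          (MvPolynomial.X (p.1, l) : MvPolynomial (MatIdx m × MatIdx m) ℂ)).toLinearMap -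
                      (LinearMap.id : MvPolynomial (MatIdx m × MatIdx m) ℂ →ₗ[ℂ] MvPolynomial (MatIdx m × MatIdx m) ℂ))) ⊓
                  (⨅ (g : Matrix.GeneralLinearGroup (MatIdx m) ℂ) (_ : IsUpperTriangular g),
                    LinearMap.ker ((MvPolynomial.aeval fun p : MatIdx m × MatIdx m =>
                        ∑ l : MatIdx m, ((g⁻¹ : Matrix.GeneralLinearGroup (MatIdx m) ℂ) :
                          Matrix (MatIdx m) (MatIdx m) ℂ) p.1 l •
                            (MvPolynomial.X (l, p.2) : MvPolynomial (MatIdx m × MatIdx m) ℂ)).toLinearMap -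
                      weightChar ((Weight.dualOfPartition (m * m) lam).toMatIdx : Weight (MatIdx m)) g •
                        (LinearMap.id : MvPolynomial (MatIdx m × MatIdx m) ℂ →ₗ[ℂ] MvPolynomial (MatIdx m × MatIdx m) ℂ)))) <
                orbitMultiplicity ℂ (paddedPerFormLex ℂ n m) m
                  ((Weight.dualOfPartition (m * m) lam).toMatIdx : Weight (MatIdx m))) :
    ValuativeFlip :=
  valuativeFlip_of_tailFlipOn {t : ℕ | t % q = a} 2 (2 * q) (windowSyndetic_of_sqGaps (sqGaps_modEq ha)) hT

end

end Summit.ValiantsHypothesis.ValiantsHypothesis.Theorems.ValuativeFlip
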